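import Summits.ABC.ABC.Theses.FeketeScales
import Summits.ABC.ABC.Theorems.FeketeScalesSparseGoodScalesWindow
import Summits.ABC.ABC.Theorems.FeketeScalesSparseGoodScalesMinimalResidue
import Summits.ABC.ABC.Theorems.FeketeScalesSparseGoodScalesRepulsion
import Summits.ABC.ABC.Theorems.FeketeScalesSparseGoodScalesGeometric
import Summits.ABC.ABC.Theorems.FeketeScalesSparseGoodScalesWieferich
import Summits.ABC.ABC.Theorems.PrimePowerRadical.Negative.WieferichSparse
import Literature.NumberTheory.DiophantineGeometry.AbcWave0
import HarnessLib

/-!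
# Strategist sketch (cstrat-stmt-ABC-2161-p1) — typed statements behind `STRATEGY-CENSUS.md`

Crux: `Summit.ABC.ABC.Theses.FeketeScales.SparseGoodScales` (stmt-ABC-2161, route FeketeScales).
This file contains NO new mathematics and no `sorry`: it TYPES the objects the census discusses
(residues, strengthenings, split candidates, the sibling statement) and certifies BY NAME which
implications are already landed theorems, so that every claim "glue landed" / "equivalent" /
"implied by the summit" in the census is kernel-checked here.

Sections: §D decomposition candidates (glue by name) · §S strengthenings (signatures + costume /
summit certificates) · §T transfer (the function-field sibling statement, from Mathlib's
Mason–Stothers) · §N negation (normal forms, binomial-sector dictionary by name).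
-/

set_option linter.dupNamespace false

namespace Summit.ABC.ABC.Cruxes.SparseGoodScales.StrategistP1

open Literature.NumberTheory.DiophantineGeometry
open Summit.ABC.ABC.Theses.FeketeScales
open Summit.ABC.ABC.Theorems
open Summit.ABC.ABC.Theorems.SparseGoodScales

/-! ## The residues (verbatim signatures used by the dead lines) -/

/-- DA∃ — droughts of SOME ratio: for every `δ` the `(1+δ)`-exceptional radicals omit, infinitely
often, a window `(R^{1/Λ}, R]` of some fixed ratio `Λ(δ) > 1`. (= `stub_droughtsOfSomeRatio` of the
dead line `SketchIdeator4`.) [folklore] -/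
def DAE : Prop :=
  ∀ δ : ℝ, 0 < δ → ∃ Λ : ℝ, 1 < Λ ∧ ∀ N : ℕ, ∃ R : ℕ, N ≤ R ∧ ∀ a b c : ℕ,
    IsABCTriple a b c → rad a b c ≤ R → (R : ℝ) < ((rad a b c : ℕ) : ℝ) ^ Λ →
      (c : ℝ) ≤ ((rad a b c : ℕ) : ℝ) ^ (1 + δ)

/-- WGS — windowed good scales (= `stub_windowedGoodScales` of the dead line `Sketch`). [folklore] -/
def WGS : Prop :=
  ∀ δ : ℝ, 0 < δ → ∀ Λ : ℝ, 1 < Λ → ∀ N : ℕ, ∃ R : ℕ, N ≤ R ∧ ∀ a b c : ℕ, IsABCTriple a b c →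
    rad a b c ≤ R → (R : ℝ) < ((rad a b c : ℕ) : ℝ) ^ Λ → (c : ℝ) ≤ (R : ℝ) ^ (1 + δ)

/-- BQ — bounded quality / polynomial abc (= `stub_boundedQuality` = item stmt-ABC-1724). [folklore] -/
def BQ : Prop :=
  ∃ A C : ℝ, ∀ a b c : ℕ, IsABCTriple a b c → (c : ℝ) ≤ C * ((rad a b c : ℕ) : ℝ) ^ A

/-- RadicalRepulsion — pairwise repulsion of `(1+δ)`-exceptional radicals (the hypothesis of the
landed `droughtsOfSomeRatio_of_radicalRepulsion`, the weakest engine in the tree). [folklore] -/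
def RadicalRepulsion : Prop :=
  ∀ δ : ℝ, 0 < δ → ∃ κ : ℝ, 0 < κ ∧ ∃ r₀ : ℕ, ∀ a b c a' b' c' : ℕ,
    IsABCTriple a b c → IsABCTriple a' b' c' →
    ((rad a b c : ℕ) : ℝ) ^ (1 + δ) < c → ((rad a' b' c' : ℕ) : ℝ) ^ (1 + δ) < c' →
    r₀ ≤ rad a b c → rad a b c < rad a' b' c' →
    ((rad a b c : ℕ) : ℝ) ^ (1 + κ) ≤ ((rad a' b' c' : ℕ) : ℝ)

/-- The Wieferich floor as a statement: infinitely many non-Wieferich primes to every prime base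
(Silverman's abc-consequence; open). [cite: Silverman1988, Thm 1] -/
def NonWieferichAllBases : Prop :=
  ∀ q : ℕ, q.Prime → {p : ℕ | p.Prime ∧ ¬ IsWieferich q p}.Infinite

/-! ## §D Decomposition candidates — every glue is a landed theorem, cited by name -/

/-- Split S2 (minimal residue): `ScaleSubmultiplicativity ∧ DA∃ ⟹ crux` — glue landed p111037. [folklore] -/
theorem splitS2 : ScaleSubmultiplicativity → DAE → SparseGoodScales :=
  fun h₁ h₂ => sparseGoodScales_of_scaleSubmultiplicativity_of_droughts h₁ h₂

/-- Split S1 (round-1 factorisation): `BQ ∧ WGS ⟹ crux` — glue landed p96117. [folklore] -/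
theorem splitS1 : BQ → WGS → SparseGoodScales :=
  fun h₁ h₂ => sparseGoodScales_of_boundedQuality_of_windowed h₁ h₂

/-- Split S3 (engine form): `ScaleSubmultiplicativity ∧ RadicalRepulsion ⟹ crux` — p107129 ∘ p111037. [folklore] -/
theorem splitS3 : ScaleSubmultiplicativity → RadicalRepulsion → SparseGoodScales :=
  fun h₁ h₂ => sparseGoodScales_of_scaleSubmultiplicativity_of_droughts h₁
    (droughtsOfSomeRatio_of_radicalRepulsion h₂)

/-- Split S4 (floor × residual): trivially valid, and TIGHT — the crux implies the floor (p99695). [folklore] -/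
theorem splitS4 : NonWieferichAllBases → (NonWieferichAllBases → SparseGoodScales) → SparseGoodScales :=
  fun h f => f h

/-- Tightness of S4: the crux implies its floor conjunct (landed p99695). [folklore] -/
theorem splitS4_tight : SparseGoodScales → NonWieferichAllBases :=
  fun h q hq => sparseGoodScales_imp_infinite_not_isWieferich h q hq

/-- Which piece remains the whole crux, in-route: under the sister crux every horizontal residue
IS the summit (landed p111037 / p96477). [folklore] -/
theorem residueS2_is_summit (hS : ScaleSubmultiplicativity) : (DAE ↔ _root_.ABC) :=
  droughtsOfSomeRatio_iff_abc_of_scaleSubmultiplicativity hS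

/-- … and so is the crux itself (p96477). [folklore] -/
theorem crux_is_summit_inRoute (hS : ScaleSubmultiplicativity) : (SparseGoodScales ↔ _root_.ABC) :=
  sparseGoodScales_iff_abc_of_scaleSubmultiplicativity hS

/-- Standalone ordering of the residues: crux ⟹ DA∃ (p111037) — the split child is weaker, never
stronger, than the parent. [folklore] -/
theorem dae_of_crux : SparseGoodScales → DAE := fun h => droughtsOfSomeRatio_of_sparseGoodScales h

/-! ## §S Strengthenings — signatures; costume and summit certificates -/

/-- S⁺₁ DOUBLING LAW (a two-scale growth law, `G`-free): every triple at scale `R²` is dominated by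
`R^{1+δ}` times SOME triple at scale `R`, for all large `R`.  Implied by ABC (`G(R) ≥ R/4`), implies
the crux along `R₀^{2^k}` by induction; an ALL-scales statement comparing two unrelated finite sets
of triples — the varying-support wall in inductive clothing (census §S1). [folklore] -/
def DoublingLaw : Prop :=
  ∀ δ : ℝ, 0 < δ → ∃ R₀ : ℕ, ∀ R : ℕ, R₀ ≤ R → ∀ a b c : ℕ, IsABCTriple a b c →
    rad a b c ≤ R * R → ∃ a' b' c' : ℕ, IsABCTriple a' b' c' ∧ rad a' b' c' ≤ R ∧
      (c : ℝ) ≤ (R : ℝ) ^ (1 + δ) * c'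

/-- S⁺₂ DA — droughts of EVERY ratio (round 1's `RadicalLacunarity` / `ExceptionalRadicalDroughts`). [folklore] -/
def DA : Prop :=
  ∀ δ : ℝ, 0 < δ → ∀ Λ : ℝ, 1 < Λ → ∀ N : ℕ, ∃ R : ℕ, N ≤ R ∧ ∀ a b c : ℕ,
    IsABCTriple a b c → rad a b c ≤ R → (R : ℝ) < ((rad a b c : ℕ) : ℝ) ^ Λ →
      (c : ℝ) ≤ ((rad a b c : ℕ) : ℝ) ^ (1 + δ)

/-- S⁺₂ is a strengthening of the residue: DA ⟹ DA∃ (landed). [folklore] -/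
theorem dae_of_da : DA → DAE := fun h => droughtsOfSomeRatio_of_every h

/-- S⁺₃ NAMED SCALES (good powers of two beyond every bound) — NOT a strengthening but a COSTUME:
equivalent to the crux (landed p109286). [folklore] -/
theorem namedScales_is_costume :
    SparseGoodScales ↔ ∀ δ : ℝ, 0 < δ → ∀ N : ℕ, ∃ j : ℕ, N ≤ j ∧ ∀ a b c : ℕ, IsABCTriple a b c →
      rad a b c ≤ 2 ^ j → (c : ℝ) ≤ ((2 ^ j : ℕ) : ℝ) ^ (1 + δ) :=
  sparseGoodScales_iff_goodPowersOfTwo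

/-- S⁺₄ = the summit: ABC ⟹ crux (p96117), ABC ⟹ DA∃ (p111037), ABC ⟹ WGS (p96477). [folklore] -/
theorem summit_gives_everything (h : _root_.ABC) : SparseGoodScales ∧ DAE ∧ WGS :=
  ⟨sparseGoodScales_of_abc h, droughtsOfSomeRatio_of_abc h, sparseGoodScales_windowed_of_abc h⟩

/-- S⁺₅ COUNTING THRESHOLD — `O_δ(log log X)` exceptional radicals below `X` (the output of a pairwise
gap principle; implies DA∃ by pigeonhole on consecutive log-ratios, BarrierNotes-r2-k4 §2).  The set
is finite by abc.S25, so `ncard` carries no junk value here. [folklore] -/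
def CountingThreshold : Prop :=
  ∀ δ : ℝ, 0 < δ → ∃ C : ℝ, ∀ X : ℕ, 3 ≤ X →
    (({r : ℕ | r ≤ X ∧ ∃ a b c : ℕ, IsABCTriple a b c ∧ rad a b c = r ∧
        ((r : ℕ) : ℝ) ^ (1 + δ) < c}).ncard : ℝ) ≤ C * Real.log (Real.log X)

/-- S⁺₆ RadicalRepulsion ⟹ DA∃ (landed p107129): the weakest engine that would settle the residue. [folklore] -/
theorem dae_of_repulsion : RadicalRepulsion → DAE := fun h => droughtsOfSomeRatio_of_radicalRepulsion h

/-! ## §T Transfer — the solved sibling's version of exactly this step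

Over `k[X]` the extremal height `G_ff(R) := max {deg c : a + b = c coprime, deg rad(abc) ≤ R}` satisfies
`G_ff(R) ≤ R − 1` at EVERY scale (Mason–Stothers), unless all derivatives vanish: the sibling has no
sparse-scale phenomenon — liminf and limsup coincide — and its proof is one differentiation
(the Wronskian `ab' − a'b`).  The transferring argument breaks at its first line over `ℤ`
(`Literature.Barriers.ABC.NoArithmeticDerivative`); in characteristic `p` the inseparable escape
clause makes `G_ff ≡ ∞` (`Literature.Barriers.ABC.MasonStothersFailsInCharP`). -/

open Polynomial UniqueFactorizationMonoid in
/-- The sibling statement: every scale is good with exponent `1` and constant `−1`, for separable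
coprime `a + b + c = 0` in `k[X]` (Mathlib `Polynomial.abc`, Literature abc.S07). [cite: Stothers1981, Mason 1984] -/
theorem sibling_everyScaleGood {k : Type*} [Field k] [DecidableEq k] {a b c : k[X]} (ha : a ≠ 0)
    (hb : b ≠ 0) (hc : c ≠ 0) (hab : IsCoprime a b) (hsum : a + b + c = 0)
    (hsep : derivative a ≠ 0) :
    c.natDegree + 1 ≤ (radical (a * b * c)).natDegree := by
  rcases mason_stothers ha hb hc hab hsum with ⟨-, -, h⟩ | ⟨hda, -, -⟩
  · exact h
  · exact absurd hda hsep

/-! ## §N Negation — normal forms of a counterexample, and the binomial-sector dictionary -/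

/-- A counterexample is a Silverman-profile sequence (landed p109286, base 2). [folklore] -/
theorem counterexample_normalForm :
    ¬ SparseGoodScales ↔ ∃ δ : ℝ, 0 < δ ∧ ∃ N : ℕ, ∀ j : ℕ, N ≤ j →
      ∃ a b c : ℕ, IsABCTriple a b c ∧ rad a b c ≤ 2 ^ j ∧ ((2 ^ j : ℕ) : ℝ) ^ (1 + δ) < (c : ℝ) :=
  not_sparseGoodScales_iff_profile (q := 2) le_rfl

/-- BINOMIAL SECTOR of the crux at a base `q ≥ 2`: sparse good POWER scales for the single family
`(1, q^k − 1, q^k)` — the sector on which the Wieferich floor lives. [folklore] -/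
def BinomialSectorSGS (q : ℕ) : Prop :=
  ∀ δ : ℝ, 0 < δ → ∀ N : ℕ, ∃ j : ℕ, N ≤ j ∧ ∀ k : ℕ, 1 ≤ k →
    rad 1 (q ^ k - 1) (q ^ k) ≤ q ^ j → ((q ^ k : ℕ) : ℝ) ≤ ((q ^ j : ℕ) : ℝ) ^ (1 + δ)

/-- The crux implies its binomial sector at every base (geometric discretisation p109286 applied to
the one family). [folklore] -/
theorem binomialSector_of_crux (h : SparseGoodScales) {q : ℕ} (hq : 2 ≤ q) : BinomialSectorSGS q := by
  intro δ hδ N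
  obtain ⟨j, hjN, hj⟩ := geometric_of_sparseGoodScales hq h δ hδ N
  refine ⟨j, hjN, fun k hk hrad => ?_⟩
  have hqk : 1 < q ^ k := Nat.one_lt_pow (by omega) (by omega)
  have habc : IsABCTriple 1 (q ^ k - 1) (q ^ k) :=
    ⟨Nat.one_pos, by omega, by omega, Nat.coprime_one_left _⟩
  exact hj 1 (q ^ k - 1) (q ^ k) habc hrad

/-- On the binomial sector the ALL-scales statement (abc for the family = item stmt-ABC-1648
`PrimePowerRadical` of route IneffectiveSubspace) is EXACTLY Wieferich sparsity (landed, cdisprove of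
1648): the dictionary "powerful excess of `q^k − 1` = odd Wieferich excess up to `k·2^{W₂}`" that makes
the floor also the ceiling on this sector. [folklore] -/
theorem binomialSector_allScales_iff_wieferichSparse :
    Summit.ABC.ABC.Theses.IneffectiveSubspace.PrimePowerRadical ↔
      ∀ q : ℕ, q.Prime → ∀ ε : ℝ, 0 < ε → ∃ C : ℝ, 0 < C ∧ ∀ k : ℕ, 1 ≤ k →
        ((PrimePowerRadical.Negative.oddWieferichExcess q k : ℕ) : ℝ) < C * (q : ℝ) ^ (ε * k) :=
  PrimePowerRadical.Negative.primePowerRadical_iff_wieferichSparse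

end Summit.ABC.ABC.Cruxes.SparseGoodScales.StrategistP1
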